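import Summits.AtomisticToContinuum.HydrodynamicLimit.Theses.BryanRoughSphereDial
import Literature.MathematicalPhysics.KineticTheory.RoughSphereFlowInline

/-!
# Birth skeleton of the crux `KappaSwapGap` (stmt-AtomisticToContinuum-9273)

Route `route-AtomisticToContinuum-BryanRoughSphereDial`, crux decl
`Summit.AtomisticToContinuum.HydrodynamicLimit.Theses.BryanRoughSphereDial.KappaSwapGap` (rank 2, the
route's load-bearing COMPARISON: pre-shock, from the same local Gibbs data, the laws of the `χ`-tested
empirical fields of the deterministic hard-sphere flow `Φ_N` and of the Bryan–Pidduck rough flow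
`R^{κ_N}`, `κ_N = r(N+1)^{-1/3}`, merge as `N → ∞` then `r → 0`, tested against 1-Lipschitz `F`, `|F| ≤ 1`).
Skeleton registrar `planner-skel-stmt-AtomisticToContinuum-9273-0`, 2026-08-17 (BC3 birth certificate;
re-audit bin REPAIRABLE). The line is the route header's own foreseen split of the crux
("KappaSwapGap ⇐ RoughSwapIdentity → RoughLinearResponse", TWO-LAYER PLAN) typed as a LINDEBERG SWAP
ALONG THE COLLISION HISTORY, with the collision budget separated out:

* the OBJECT is the family of HYBRID FLOWS `H^{m,κ}` (`hybridFlow κ m`): the library's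
  collision-by-collision construction `Carrying.flow` (CIP1994 App. 4.A; same free flight, same exit
  times `Alexander.freeExitTime`, same partner selection `Alexander.incomingPairs` as `roughFlow` and as
  `Alexander.fwdFlow`) on the extended phase space `(z, s, c)` — configuration, normalised spins, and a
  collision COUNTER `c` — whose pair rule is Bryan's rule `roughPair κ` while `c < m` and the smooth rule
  `roughPair 0` (specular on the translational factor, `RoughSphere.fst_pair_zero`; passive spins) from
  collision `m + 1` on. `H^{0,κ}` is the hard-sphere flow with passive spins (translational projection
  `= Alexander.fwdFlow` by `Carrying.fst_flow`), and `H^{m,κ}_t = R^κ_t` as soon as `m ≥` the number of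
  collisions of `R^κ` in `[0,t]`; consecutive hybrids `H^{m,κ}`, `H^{m+1,κ}` share the first `m` (rough)
  collisions and the `(m+1)`-th collision instant, differ there by ONE tangential impulse
  `-κ(1+κ)⁻¹gₜ - √κ(1+κ)⁻¹ k × S` (ChapmanCowling1970 (11.2,7)), and both run the SMOOTH dynamics after it.
  The `m`-th SWAP TERM `swapTerm … m = E F(fields(H^{m+1,κ}_t)) − E F(fields(H^{m,κ}_t))` (expectations
  under the rough local Gibbs law `P_N ⊗ spinLaw N`, thermal spins attached by `roughInit θ₀`) is
  supported on the event `activeProb … m = (P_N ⊗ γ)(τ^κ_{m+1} ≤ t)` that the switched collision happens.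
* `stub_swapTelescope` (S1, RoughSwapIdentity at law level; measure theory + well-posedness, size M,
  provable now): `|E_{P_N} F(fields(Φ_{N,t})) − E_{P_N⊗γ} F(fields(R^κ_t))| ≤ Σ_m |swapTerm m|` (in `ℝ≥0∞`, so
  no summability side condition). Content: ANCHORING — an arbitrary `HardSphereFlow` structure `Φ_N`
  agrees `P_N`-a.e. with Alexander's flow (`HardSphereFlow.flow_eq_ae_holds`, `regHardSphereFlow`;
  `P_N ≪` Liouville by `particleLaw`), which is the translational projection of `H^{0,κ}` (and of `R^0`:
  `fst_roughFlow_zero`, the route's KappaZeroReduction); TELESCOPING `F(H^{M}) − F(H^0) = Σ_{m<M} (…)`; and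
  `H^{m,κ}_t = R^κ_t` eventually in `m`, `P_N ⊗ γ`-a.s., because the rough recursion's instants do not
  accumulate (the route's support item RoughWellPosed (b), transported through `roughInit θ₀`, `θ₀ > 0`),
  plus measurability of the hybrid maps (RoughWellPosed (a) for the carrying construction) and dominated
  convergence (`|F| ≤ 1`).
* `stub_oneSwitchResponse` (S2, RoughLinearResponse — THE HEART, open-problem strength): in the crux's
  frame (profiles, `σ < σ₀`, a classical hs-Euler solution on `[0,T)` whose data the local Gibbs fields
  match at `t = 0`, `t < T`, continuous `χ`, 1-Lipschitz `F` with `|F| ≤ 1`) there are a window `r₁ > 0`, a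
  constant `C` and `N₁` such that for `N ≥ N₁`, every `κ ≤ r₁(N+1)^{-1/3}` and EVERY collision index `m`:
  `|swapTerm m| ≤ C·κ/(N+1) · (P_N⊗γ)(τ^κ_{m+1} ≤ t)`. One switched collision changes the pair's velocities
  by `O(√κ)` with a SIGN carried by the thermal pair spin `k × S` and by `O(κ)` systematically (tangential
  friction), i.e. the `χ`-tested fields by `O(√κ/N)` resp. `O(κ/N)` at the switching time; the claim is that
  IN LAW, after the smooth chaotic hard-sphere evolution to time `t`, the first-order `√κ` effect averages
  out (spin sign / SpinChaos at collision `m+1` of the rough history) and the mean response stays `O(κ/N)`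
  uniformly in `N`, `m` and the elapsed time — law-level linear response / stochastic stability of
  pre-shock hard-sphere field statistics under one contact kick (Kifer1990 class; MischlerMouhot2012-type
  stability is the nearest printed technology, for Kac/Boltzmann dynamics only). This stub carries the
  crux's why-line verbatim (paths decorrelate after `O(1)` collisions; only the LAW can be stable).
* `stub_collisionBudget` (S3, kinetic collision count under local Gibbs data; size M–L, known technology):
  `Σ_m (P_N⊗γ)(τ^κ_{m+1} ≤ t) ≤ C'(N+1)^{4/3}` for `N ≥ N₂`, uniformly in `κ ∈ [0,1]` — the expected number
  of collisions of the rough gas in `[0,t]` is `O(N · σ²(N+1)^{1/3} · t)` (`N+1` spheres of diameter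
  `σ(N+1)^{-1/3}`, thermal speeds). Liouville ⊗ Lebesgue invariance of `R^κ` (RoughWellPosed (c)) makes
  Gibbs ⊗ Maxwell-spins stationary for every `κ ≥ 0` with the SAME contact statistics as smooth spheres,
  where the landed rung-0 Campbell bound `E_G #coll(0,τ] ≤ 16τ(N+1)²ε_N² ∫‖v−w‖dN^{⊗2}` of
  `Theorems.EnergyCurrentTailsLevelCensus.localGibbsLaw_lintegral_le_of_le_collisionPreMarkSum` has exactly
  this order (`(N+1)²ε_N² = σ²(N+1)^{4/3}`); the transfer from the homogeneous Gibbs law `G_N` to the LOCAL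
  Gibbs law `P_N` uniformly in `N` is the work: entropy inequality `E_P X ≤ α⁻¹(H(P_N|G_N) + log E_G e^{αX})`
  with `H(P_N|G_N) = O(N)` and `α ≍ N^{-1/3}`, which needs `log E_G exp(N^{-1/3} #coll_t) = O(N)` (an
  exponential moment of the per-particle collision count; velocity-scaling large deviations are of this
  order). NOT the refuted uniform-in-marks Stosszahlansatz ceiling `ContactIntensityDomination`
  (negatives index, stmt-9218): only the constant mark and a profile-dependent constant occur here.
* Composition `KappaSwapGap_of : S1 → S2 → S3 → KappaSwapGap` (sorry-free; real content: the crux's inline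
  `let` telescope is turned into library language by the rw-bridge `roughFlow_inline / roughInit_inline /
  spinLaw_inline` (`Literature…RoughSphereFlowInline`), the density threshold `min (min σ₂ σ₃) 2⁻¹`, the
  dial bookkeeping `κ_N(N+1)^{1/3} = r`, `(N+1)^{4/3} = (N+1)(N+1)^{1/3}`, the `ℝ≥0∞` chaining
  `ofReal |gap| ≤ Σ ofReal |swapTerm| ≤ ofReal(Cκ/(N+1)) Σ activeProb ≤ ofReal(C C' r)`, and the choice
  `r₀ = min r₁ (min 1 (η/(C C'+1)))`, `N₀ = max N₁ N₂` INDEPENDENT of `r`), and `KappaSwapGap_skeleton` = the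
  crux modulo the three sorries.

Disproof used: none exists for this crux at registration (`ledger crux ls stmt-AtomisticToContinuum-9273`:
no workfiles). Negatives index (`ledger negatives --problem AtomisticToContinuum`): no refuted statement is
an instance of S1–S3 (no entropy clamp, no kinetic window, no Lambertian kernel; the rough dial's items have
never been refuted).
-/

noncomputable section

open MeasureTheory Filter Set
open scoped ENNReal Topology

namespace Summit.AtomisticToContinuum.HydrodynamicLimit.Cruxes.KappaSwapGap.Birth

open Literature.MathematicalPhysics.KineticTheory Literature.Analysis.FluidPDE
open Summit.AtomisticToContinuum.HydrodynamicLimit.Theses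

/-! ## §0 Objects of the line -/

/-- Extended phase space of `N + 1` rough spheres on `𝕋³`: configurations × normalised spins (the crux's
`Cfg N × Spin N`). -/
abbrev Ext (N : ℕ) : Type := Config (N + 1) (Fin 3) T3 × (Fin (N + 1) → V3)

/-- Hybrid phase space: extended phase space × a collision counter (the internal coordinates `Y` of the
library's `Carrying` construction are here `spins × ℕ`). -/
abbrev HExt (N : ℕ) : Type := Config (N + 1) (Fin 3) T3 × ((Fin (N + 1) → V3) × ℕ)

/-- The three `χ`-tested empirical fields of a configuration (verbatim the crux's `fld`). -/
def fields {n : ℕ} (z : Config n (Fin 3) T3) (χ : T3 → ℝ) : ℝ × V3 × ℝ :=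
  (empiricalDensityField z χ, empiricalMomentumField z χ, empiricalEnergyField z χ)

/-- The rough local Gibbs law on the extended phase space: `P_N ⊗ spinLaw N` (the crux's
`(P N).prod (spinLaw N)`; thermal spins are then attached by `roughInit θ₀`). -/
def roughLaw (σ : ℝ) (a₀ : T3 → ℝ) (u₀ : T3 → V3) (θ₀ : T3 → ℝ) (N : ℕ)
    (Φ : HardSphereFlow (Torus.geometry (Fin 3)) (hsDiameter σ N) (N + 1)) : Measure (Ext N) :=
  (localGibbsLaw σ a₀ u₀ θ₀ N Φ).prod (spinLaw N)

/-- **The hybrid pair rule** `H^{m,κ}`: Bryan's rule `roughPair κ` at the first `m` collisions of the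
history (counter `c < m`), the smooth rule `roughPair 0` (specular reflection on the translational
factor, passive spins) from collision `m + 1` on; the counter is incremented at every resolved
collision. -/
def hybridPair {N : ℕ} (κ : ℝ) (m : ℕ) (i j : Fin (N + 1)) (q : HExt N) : HExt N :=
  ((roughPair (if q.2.2 < m then κ else 0) i j (q.1, q.2.1)).1,
    ((roughPair (if q.2.2 < m then κ else 0) i j (q.1, q.2.1)).2, q.2.2 + 1))

/-- **The hybrid flow** `H^{m,κ}_t`: the library's collision-by-collision construction `Carrying.flow`
(free flight to `Alexander.freeExitTime`, rule on the incoming contact pair, iterate; right-continuous)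
driven by the hybrid rule, for `N + 1` spheres of diameter `hsDiameter σ N` on `𝕋³`. -/
def hybridFlow (κ : ℝ) (m : ℕ) (σ : ℝ) (N : ℕ) (q : HExt N) (t : ℝ) : HExt N :=
  Carrying.flow (Torus.geometry (Fin 3)) (hsDiameter σ N) (hybridPair κ m) q t

/-- Initial hybrid state: thermal spins attached (`roughInit θ₀`), counter at `0`. -/
def hybridInit {N : ℕ} (θ₀ : T3 → ℝ) (p : Ext N) : HExt N :=
  ((roughInit θ₀ p).1, ((roughInit θ₀ p).2, 0))

/-- The hard-sphere side of the gap: `E_{P_N} F(fields(Φ_t z))`. -/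
def hsMean (σ : ℝ) (a₀ : T3 → ℝ) (u₀ : T3 → V3) (θ₀ : T3 → ℝ) (N : ℕ)
    (Φ : HardSphereFlow (Torus.geometry (Fin 3)) (hsDiameter σ N) (N + 1)) (t : ℝ) (χ : T3 → ℝ)
    (F : ℝ × V3 × ℝ → ℝ) : ℝ :=
  ∫ z, F (fields (Φ.flow t z) χ) ∂(localGibbsLaw σ a₀ u₀ θ₀ N Φ)

/-- The rough side of the gap at roughness `κ`: `E_{P_N ⊗ γ} F(fields((R^κ_t (roughInit θ₀ p)).1))`. -/
def roughMean (σ : ℝ) (a₀ : T3 → ℝ) (u₀ : T3 → V3) (θ₀ : T3 → ℝ) (N : ℕ)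
    (Φ : HardSphereFlow (Torus.geometry (Fin 3)) (hsDiameter σ N) (N + 1)) (κ t : ℝ) (χ : T3 → ℝ)
    (F : ℝ × V3 × ℝ → ℝ) : ℝ :=
  ∫ p, F (fields ((roughFlow κ σ N (roughInit θ₀ p) t).1) χ) ∂(roughLaw σ a₀ u₀ θ₀ N Φ)

/-- The hybrid mean with `m` rough collisions: `E_{P_N ⊗ γ} F(fields((H^{m,κ}_t (hybridInit θ₀ p)).1))`. -/
def hybridMean (σ : ℝ) (a₀ : T3 → ℝ) (u₀ : T3 → V3) (θ₀ : T3 → ℝ) (N : ℕ)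
    (Φ : HardSphereFlow (Torus.geometry (Fin 3)) (hsDiameter σ N) (N + 1)) (κ : ℝ) (m : ℕ) (t : ℝ)
    (χ : T3 → ℝ) (F : ℝ × V3 × ℝ → ℝ) : ℝ :=
  ∫ p, F (fields ((hybridFlow κ m σ N (hybridInit θ₀ p) t).1) χ) ∂(roughLaw σ a₀ u₀ θ₀ N Φ)

/-- **The `m`-th swap term** (Lindeberg increment): the change of the mean tested observable at time
`t` when collision `m + 1` of the history is switched from the smooth to the rough rule (all earlier
collisions rough, all later ones smooth). -/
def swapTerm (σ : ℝ) (a₀ : T3 → ℝ) (u₀ : T3 → V3) (θ₀ : T3 → ℝ) (N : ℕ)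
    (Φ : HardSphereFlow (Torus.geometry (Fin 3)) (hsDiameter σ N) (N + 1)) (κ t : ℝ) (χ : T3 → ℝ)
    (F : ℝ × V3 × ℝ → ℝ) (m : ℕ) : ℝ :=
  hybridMean σ a₀ u₀ θ₀ N Φ κ (m + 1) t χ F - hybridMean σ a₀ u₀ θ₀ N Φ κ m t χ F

/-- **Activity of the `m`-th swap**: the `P_N ⊗ γ`-probability that the `(m+1)`-th collision instant of
the rough flow `R^κ` (shared with `H^{m,κ}` and `H^{m+1,κ}`) falls in `[0, t]` — the support of the
`m`-th swap term; `Σ_m activeProb … m` is the expected number of collisions in `[0, t]`, stated through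
the instants (no `sSup` junk). -/
def activeProb (σ : ℝ) (a₀ : T3 → ℝ) (u₀ : T3 → V3) (θ₀ : T3 → ℝ) (N : ℕ)
    (Φ : HardSphereFlow (Torus.geometry (Fin 3)) (hsDiameter σ N) (N + 1)) (κ t : ℝ) (m : ℕ) : ℝ≥0∞ :=
  roughLaw σ a₀ u₀ θ₀ N Φ {p | roughInstant κ σ N (roughInit θ₀ p) (m + 1) ≤ ENNReal.ofReal t}

/-! ## §1 Stub signatures

Each stub's statement is the `Prop` `Sig.stub_<name>`; the registered obligation is
`theorem stub_<name> : Sig.stub_<name> := by sorry` (§2); the composition `KappaSwapGap_of` takes the three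
signatures as hypotheses BY NAME. -/

/-- **S1 — the swap telescope (RoughSwapIdentity at law level; size M, provable now).** For
`0 < σ < 1/2`, continuous positive profiles, every `N`, every hard-sphere flow structure `Φ`, every
`κ ≥ 0`, `t ≥ 0`, continuous `χ` and 1-Lipschitz `F` with `|F| ≤ 1`: the gap between the hard-sphere
mean and the rough mean is at most the sum over the collision history of the absolute swap terms (in
`ℝ≥0∞`). Content: anchoring of the arbitrary `Φ` to Alexander's construction `P_N`-a.e.
(`HardSphereFlow.flow_eq_ae_holds`, `P_N ≪` Liouville) = the translational projection of `H^{0,κ}`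
(`Carrying.fst_flow`, `RoughSphere.fst_pair_zero`); finite telescoping; `H^{m,κ}_t = R^κ_t` eventually in
`m`, a.s. (non-accumulation of the rough instants, RoughWellPosed (b), through `roughInit θ₀` with
`θ₀ > 0`); measurability of the hybrid maps; dominated convergence. Why it might fail: only through a
measurability / null-set transport slip — the identity itself is exact. -/
def Sig.stub_swapTelescope : Prop :=
  ∀ σ : ℝ, 0 < σ → σ < 2⁻¹ →
    ∀ (a₀ θ₀ : T3 → ℝ) (u₀ : T3 → V3), Continuous a₀ → Continuous θ₀ → Continuous u₀ →
      (∀ x, 0 < a₀ x) → (∀ x, 0 < θ₀ x) →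
      ∀ (N : ℕ) (Φ : HardSphereFlow (Torus.geometry (Fin 3)) (hsDiameter σ N) (N + 1)) (κ : ℝ),
        0 ≤ κ → ∀ t : ℝ, 0 ≤ t → ∀ χ : T3 → ℝ, Continuous χ → ∀ F : ℝ × V3 × ℝ → ℝ,
          LipschitzWith 1 F → (∀ y, |F y| ≤ 1) →
            ENNReal.ofReal |hsMean σ a₀ u₀ θ₀ N Φ t χ F - roughMean σ a₀ u₀ θ₀ N Φ κ t χ F| ≤
              ∑' m, ENNReal.ofReal |swapTerm σ a₀ u₀ θ₀ N Φ κ t χ F m|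

/-- **S2 — one-switch linear response in law (RoughLinearResponse; THE HEART, open-problem strength).**
In the crux's frame there are a window `r₁ > 0`, a constant `C ≥ 0` and `N₁` such that for `N ≥ N₁`,
every roughness `0 ≤ κ ≤ r₁(N+1)^{-1/3}` and every collision index `m`, the `m`-th swap term is at most
`C·κ/(N+1)` times the probability that the switched collision happens before `t`. Why plausibly true:
the switch perturbs one pair's velocities by `-κ(1+κ)⁻¹gₜ ∓ √κ(1+κ)⁻¹ k × S` (fields by `O(√κ/N)`), the
`√κ`-part has a sign carried by the thermal pair spin and cancels in the mean to first order, leaving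
`O(κ/N)`; the bet is that the LAW-level response of pre-shock hard-sphere field statistics to one contact
kick is bounded uniformly in `N`, `m` and the elapsed time. Why it might fail (the crux's why-line):
paths decorrelate after `O(1)` collisions (Lyapunov rate `≍ N^{1/3}`), so only statistical cancellation
can keep the mean response `O(κ/N)`; spin–velocity correlations built by the rough history could bias
the sign average at order `√κ`·(persistent), and an `O(ρσ³)` ring bias could survive. In global
equilibrium every swap term vanishes identically (each hybrid preserves Gibbs ⊗ Maxwell-spins: both rules
map the incoming flux measure onto the outgoing one), so the content is linear response AROUND LOCAL
equilibrium. Repair foreseen if only the SUM over `m` is `O(r)` (cancellations across collisions — the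
header's "martingale, not Gronwall" caveat): re-cut S1 with the signed series and bound partial sums. -/
def Sig.stub_oneSwitchResponse : Prop :=
  ∀ (a₀ θ₀ : T3 → ℝ) (u₀ : T3 → V3), Continuous a₀ → Continuous θ₀ → Continuous u₀ →
    (∀ x, 0 < a₀ x) → (∀ x, 0 < θ₀ x) →
    ∃ σ₀ : ℝ, 0 < σ₀ ∧ ∀ σ : ℝ, 0 < σ → σ < σ₀ →
      ∀ (T : ℝ) (ρ θ : ℝ → T3 → ℝ) (u : ℝ → T3 → V3), IsHardSphereEulerSolution σ T ρ u θ →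
        ∀ Φ : (N : ℕ) → HardSphereFlow (Torus.geometry (Fin 3)) (hsDiameter σ N) (N + 1),
          TendstoHydroFieldsAt (fun N => localGibbsLaw σ a₀ u₀ θ₀ N (Φ N)) Φ ρ u θ 0 →
            ∀ t ∈ Ico 0 T, ∀ χ : T3 → ℝ, Continuous χ → ∀ F : ℝ × V3 × ℝ → ℝ,
              LipschitzWith 1 F → (∀ y, |F y| ≤ 1) →
                ∃ r₁ : ℝ, 0 < r₁ ∧ ∃ C : ℝ, 0 ≤ C ∧ ∃ N₁ : ℕ, ∀ N : ℕ, N₁ ≤ N →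
                  ∀ κ : ℝ, 0 ≤ κ → κ ≤ r₁ * ((N : ℝ) + 1) ^ (-(1 / 3 : ℝ)) → ∀ m : ℕ,
                    |swapTerm σ a₀ u₀ θ₀ N (Φ N) κ t χ F m| ≤
                      C * κ / ((N : ℝ) + 1) * (activeProb σ a₀ u₀ θ₀ N (Φ N) κ t m).toReal

/-- **S3 — the collision budget (mean number of collisions under local Gibbs data; size M–L).** For
continuous positive profiles and `σ < σ₀(profiles)`, every flow family and every `t ≥ 0` there are
`C' ≥ 0` and `N₂` such that for `N ≥ N₂` and every `κ ∈ [0, 1]` the expected number of collision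
instants of the rough flow in `[0, t]` under `P_N ⊗ γ` — written `Σ_m (P_N ⊗ γ)(τ^κ_{m+1} ≤ t)` — is at
most `C'(N+1)^{4/3}` (`N + 1` spheres × collision frequency `≍ σ²(N+1)^{1/3}` × `t`). Why plausibly
true: Gibbs ⊗ Maxwell-spins is stationary for `R^κ` (Liouville ⊗ Lebesgue invariance, RoughWellPosed (c),
+ energy conservation `RoughSphere.roughEnergy_pair`) with the smooth spheres' contact statistics, for
which the landed rung-0 Campbell bound `localGibbsLaw_lintegral_le_of_le_collisionPreMarkSum`
(`Theorems.EnergyCurrentTailsLevelCensus`, mark `A ≡ 1`) gives exactly `O(τ(N+1)²ε_N²) = O(σ²τ(N+1)^{4/3})`,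
and local Gibbs is controlled by global Gibbs via the entropy inequality with `H(P_N | G_N) = O(N)`. Why it
might fail: the entropy-inequality transfer (`α ≍ N^{-1/3}`) needs `log E_G exp(N^{-1/3}·#coll_t) = O(N)`,
an exponential-moment bound for collision counts in equilibrium that is not in print for hard spheres at
fixed reduced density; a cruder (sup-norm) domination of `P_N` by `G_N` costs `e^{O(N)}`. -/
def Sig.stub_collisionBudget : Prop :=
  ∀ (a₀ θ₀ : T3 → ℝ) (u₀ : T3 → V3), Continuous a₀ → Continuous θ₀ → Continuous u₀ →
    (∀ x, 0 < a₀ x) → (∀ x, 0 < θ₀ x) →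
    ∃ σ₀ : ℝ, 0 < σ₀ ∧ ∀ σ : ℝ, 0 < σ → σ < σ₀ →
      ∀ Φ : (N : ℕ) → HardSphereFlow (Torus.geometry (Fin 3)) (hsDiameter σ N) (N + 1),
        ∀ t : ℝ, 0 ≤ t → ∃ C' : ℝ, 0 ≤ C' ∧ ∃ N₂ : ℕ, ∀ N : ℕ, N₂ ≤ N →
          ∀ κ : ℝ, 0 ≤ κ → κ ≤ 1 →
            ∑' m, activeProb σ a₀ u₀ θ₀ N (Φ N) κ t m ≤
              ENNReal.ofReal (C' * ((N : ℝ) + 1) ^ (4 / 3 : ℝ))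

/-! ## §2 Stubs (registered; `sorry` only inside them) — hardest: `stub_oneSwitchResponse` -/

/-- **S1 (M, provable now).** The swap telescope: anchoring + Lindeberg telescoping + a.s. exhaustion. -/
theorem stub_swapTelescope : Sig.stub_swapTelescope := by
  sorry

/-- **S2 (the heart).** One-switch linear response in law, `O(κ/N)` per active switch. -/
theorem stub_oneSwitchResponse : Sig.stub_oneSwitchResponse := by
  sorry

/-- **S3 (M–L).** The collision budget `O((N+1)^{4/3})` under rough local Gibbs data. -/
theorem stub_collisionBudget : Sig.stub_collisionBudget := by
  sorry

/-! ## §3 Composition (sorry-free) -/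

/-- **The line closes the crux modulo its stubs**: `KappaSwapGap` BY NAME from S1, S2, S3. Real content:
the rw-bridge from the crux's inline `let` telescope to the library names (`roughFlow_inline`,
`roughInit_inline`, `spinLaw_inline`), the common density threshold `min (min σ₂ σ₃) 2⁻¹`, the dial
bookkeeping `κ_N (N+1)^{1/3} = r` and `(N+1)^{4/3} = (N+1)(N+1)^{1/3}`, the `ℝ≥0∞` chaining
telescope ∘ response ∘ budget, and the choices `r₀ = min r₁ (min 1 (η / (C C' + 1)))`, `N₀ = max N₁ N₂`. -/
theorem KappaSwapGap_of (h₁ : Sig.stub_swapTelescope) (h₂ : Sig.stub_oneSwitchResponse)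
    (h₃ : Sig.stub_collisionBudget) : BryanRoughSphereDial.KappaSwapGap := by
  intro a₀ θ₀ u₀ ha hθ hu hap hθp
  obtain ⟨σ₂, hσ₂, H₂⟩ := h₂ a₀ θ₀ u₀ ha hθ hu hap hθp
  obtain ⟨σ₃, hσ₃, H₃⟩ := h₃ a₀ θ₀ u₀ ha hθ hu hap hθp
  refine ⟨min (min σ₂ σ₃) 2⁻¹, lt_min (lt_min hσ₂ hσ₃) (by norm_num), ?_⟩
  intro σ hσ hσlt T ρ θ u hsol Φ P h0 t ht χ hχ F hF hFb η hη
  have hσ₂' : σ < σ₂ := hσlt.trans_le ((min_le_left _ _).trans (min_le_left _ _))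
  have hσ₃' : σ < σ₃ := hσlt.trans_le ((min_le_left _ _).trans (min_le_right _ _))
  have hσh : σ < 2⁻¹ := hσlt.trans_le (min_le_right _ _)
  -- the heart and the budget, instantiated
  obtain ⟨r₁, hr₁, C, hC, N₁, HC⟩ := H₂ σ hσ hσ₂' T ρ θ u hsol Φ h0 t ht χ hχ F hF hFb
  obtain ⟨C', hC', N₂, HC'⟩ := H₃ σ hσ hσ₃' Φ t ht.1
  -- the window
  refine ⟨min r₁ (min 1 (η / (C * C' + 1))), lt_min hr₁ (lt_min one_pos (by positivity)), ?_⟩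
  intro r hr hrlt
  have hr₁' : r < r₁ := hrlt.trans_le (min_le_left _ _)
  have hr1 : r < 1 := hrlt.trans_le ((min_le_right _ _).trans (min_le_left _ _))
  have hrη : r < η / (C * C' + 1) := hrlt.trans_le ((min_le_right _ _).trans (min_le_right _ _))
  refine ⟨max N₁ N₂, fun N hN => ?_⟩
  have hN₁ : N₁ ≤ N := le_of_max_le_left hN
  have hN₂ : N₂ ≤ N := le_of_max_le_right hN
  -- the dial
  set κ : ℝ := r * ((N : ℝ) + 1) ^ (-(1 / 3 : ℝ)) with hκdef
  have hN1 : (0 : ℝ) < (N : ℝ) + 1 := by positivity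
  have hpow_nonneg : (0 : ℝ) ≤ ((N : ℝ) + 1) ^ (-(1 / 3 : ℝ)) := Real.rpow_nonneg hN1.le _
  have hpow_le_one : ((N : ℝ) + 1) ^ (-(1 / 3 : ℝ)) ≤ 1 :=
    Real.rpow_le_one_of_one_le_of_nonpos (by linarith [hN1]) (by norm_num)
  have hκ0 : 0 ≤ κ := mul_nonneg hr.le hpow_nonneg
  have hκr₁ : κ ≤ r₁ * ((N : ℝ) + 1) ^ (-(1 / 3 : ℝ)) :=
    mul_le_mul_of_nonneg_right hr₁'.le hpow_nonneg
  have hκ1 : κ ≤ 1 := by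
    calc κ ≤ 1 * 1 := mul_le_mul hr1.le hpow_le_one hpow_nonneg zero_le_one
      _ = 1 := one_mul 1
  have hκN : κ * ((N : ℝ) + 1) ^ (1 / 3 : ℝ) = r := by
    rw [hκdef, mul_assoc, Real.rpow_neg hN1.le, inv_mul_cancel₀ (Real.rpow_pos_of_pos hN1 _).ne',
      mul_one]
  have hpow43 : ((N : ℝ) + 1) ^ (4 / 3 : ℝ) = ((N : ℝ) + 1) * ((N : ℝ) + 1) ^ (1 / 3 : ℝ) := by
    rw [show (4 / 3 : ℝ) = 1 + 1 / 3 by norm_num, Real.rpow_add hN1, Real.rpow_one]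
  have hprod : C * κ / ((N : ℝ) + 1) * (C' * ((N : ℝ) + 1) ^ (4 / 3 : ℝ)) = C * C' * r := by
    rw [hpow43, ← hκN]
    field_simp
  -- S1: telescope
  have h1 : ENNReal.ofReal |hsMean σ a₀ u₀ θ₀ N (Φ N) t χ F - roughMean σ a₀ u₀ θ₀ N (Φ N) κ t χ F| ≤
      ∑' m, ENNReal.ofReal |swapTerm σ a₀ u₀ θ₀ N (Φ N) κ t χ F m| :=
    h₁ σ hσ hσh a₀ θ₀ u₀ ha hθ hu hap hθp N (Φ N) κ hκ0 t ht.1 χ hχ F hF hFb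
  -- S2: each swap term against its activity
  have h2 : ∀ m, ENNReal.ofReal |swapTerm σ a₀ u₀ θ₀ N (Φ N) κ t χ F m| ≤
      ENNReal.ofReal (C * κ / ((N : ℝ) + 1)) * activeProb σ a₀ u₀ θ₀ N (Φ N) κ t m := by
    intro m
    calc ENNReal.ofReal |swapTerm σ a₀ u₀ θ₀ N (Φ N) κ t χ F m|
        ≤ ENNReal.ofReal (C * κ / ((N : ℝ) + 1) * (activeProb σ a₀ u₀ θ₀ N (Φ N) κ t m).toReal) :=
          ENNReal.ofReal_le_ofReal (HC N hN₁ κ hκ0 hκr₁ m)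
      _ = ENNReal.ofReal (C * κ / ((N : ℝ) + 1)) *
            ENNReal.ofReal ((activeProb σ a₀ u₀ θ₀ N (Φ N) κ t m).toReal) :=
          ENNReal.ofReal_mul (by positivity)
      _ ≤ ENNReal.ofReal (C * κ / ((N : ℝ) + 1)) * activeProb σ a₀ u₀ θ₀ N (Φ N) κ t m :=
          mul_le_mul' le_rfl ENNReal.ofReal_toReal_le
  -- S3: the budget
  have h3 : ∑' m, activeProb σ a₀ u₀ θ₀ N (Φ N) κ t m ≤
      ENNReal.ofReal (C' * ((N : ℝ) + 1) ^ (4 / 3 : ℝ)) := HC' N hN₂ κ hκ0 hκ1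
  -- chaining in ℝ≥0∞
  have h4 : ENNReal.ofReal |hsMean σ a₀ u₀ θ₀ N (Φ N) t χ F - roughMean σ a₀ u₀ θ₀ N (Φ N) κ t χ F| ≤
      ENNReal.ofReal (C * C' * r) := by
    calc ENNReal.ofReal |hsMean σ a₀ u₀ θ₀ N (Φ N) t χ F - roughMean σ a₀ u₀ θ₀ N (Φ N) κ t χ F|
        ≤ ∑' m, ENNReal.ofReal |swapTerm σ a₀ u₀ θ₀ N (Φ N) κ t χ F m| := h1
      _ ≤ ∑' m, ENNReal.ofReal (C * κ / ((N : ℝ) + 1)) * activeProb σ a₀ u₀ θ₀ N (Φ N) κ t m :=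
          ENNReal.tsum_le_tsum h2
      _ = ENNReal.ofReal (C * κ / ((N : ℝ) + 1)) * ∑' m, activeProb σ a₀ u₀ θ₀ N (Φ N) κ t m :=
          ENNReal.tsum_mul_left
      _ ≤ ENNReal.ofReal (C * κ / ((N : ℝ) + 1)) * ENNReal.ofReal (C' * ((N : ℝ) + 1) ^ (4 / 3 : ℝ)) :=
          mul_le_mul' le_rfl h3
      _ = ENNReal.ofReal (C * κ / ((N : ℝ) + 1) * (C' * ((N : ℝ) + 1) ^ (4 / 3 : ℝ))) :=
          (ENNReal.ofReal_mul (by positivity)).symm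
      _ = ENNReal.ofReal (C * C' * r) := by rw [hprod]
  have h5 : |hsMean σ a₀ u₀ θ₀ N (Φ N) t χ F - roughMean σ a₀ u₀ θ₀ N (Φ N) κ t χ F| ≤ C * C' * r :=
    (ENNReal.ofReal_le_ofReal_iff (by positivity)).1 h4
  have h6 : C * C' * r ≤ η := by
    have hden : 0 < C * C' + 1 := by positivity
    have : C * C' * r ≤ (C * C' + 1) * r := by nlinarith [hr.le]
    calc C * C' * r ≤ (C * C' + 1) * r := this
      _ ≤ (C * C' + 1) * (η / (C * C' + 1)) := by gcongr
      _ = η := mul_div_cancel₀ η hden.ne'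
  have key : |hsMean σ a₀ u₀ θ₀ N (Φ N) t χ F - roughMean σ a₀ u₀ θ₀ N (Φ N) κ t χ F| ≤ η :=
    h5.trans h6
  -- back to the crux's inline language
  rw [roughFlow_inline, roughInit_inline, spinLaw_inline]
  beta_reduce
  exact key

/-- The skeleton instantiated: the crux modulo the three registered stubs. -/
theorem KappaSwapGap_skeleton : BryanRoughSphereDial.KappaSwapGap :=
  KappaSwapGap_of stub_swapTelescope stub_oneSwitchResponse stub_collisionBudget

end Summit.AtomisticToContinuum.HydrodynamicLimit.Cruxes.KappaSwapGap.Birth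

end
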